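import Literature.MathematicalPhysics.QuantumFieldTheory.Balaban1983to89.B11Ineq189Census
import Literature.MathematicalPhysics.QuantumFieldTheory.Balaban1983to89.B11Prop9ModelNonVacuity
import Literature.MathematicalPhysics.QuantumFieldTheory.Balaban1983to89.B11Ineq189LocalLeaf

/-!
# `Balaban1983to89.B11Ineq189CensusNorm` — [Balaban1985Variational] p. 308, (189): the JUNCTION between the typed term
# census (`B11Ineq189Census`, majorant calculus over `B6.Geometry`) and the norm-level analytic leaves
# (`B11Ineq189LocalLeaf` ∕ `…LeafCk` ∕ `…LeafD`): on the one-site normed carrier the census binders ARE operator-norm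
# bounds, and the leaf constant `9C₂` (‖D²C(X)‖ ≤ 9C₂) plugs into the `hloc` ∕ `HasMaj₂` binder BY NAME

statement-level skeleton of published theorems with citation tags; proofs where landed; nothing here is a claim about
the Yang–Mills mass gap.

CITATION HEADER.  Source under audit: T. Bałaban, *The variational problem and background fields in renormalization group
method for lattice gauge theories*, Commun. Math. Phys. **102**, 277–309 (1985) [Balaban1985Variational] (p. 308 (189); (71),
(73) pp. 288–289; (85)–(96) pp. 291–292); [3] = [Balaban1984PropagatorsII] ((2.51)–(2.56), Lemma 2.1); [4] =
[Balaban1985Averaging] (Prop. 4 (134)–(135), Prop. 7).  Displays are quoted in `B11Ineq189` ∕ `B11SectG` ∕ `B11Ineq189LocalLeaf`;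
nothing of the series is asserted here.

WHY THIS FILE EXISTS (YM-DAG node N07 = [B11], -b₂ seat `pub-ymgap-dag-n21-b`, dag-lead [DAGLEAD-G0-REBALANCE-17-N21B-ALPHA];
cell GAPS G-B11-G2 «We do not perform these calculations here»).  The (189) programme now has (i) the census ROWS as kernel
theorems over abstract block-normed carriers (`B11Ineq189Census`: SHAPE L `comp_quarter`∕`termT21`…, SHAPE B `termT1`…,
`d2D2_hasMaj₂`, `ineq189_of_groups`) whose analytic inputs are binders — in particular the LOCAL BILINEAR LEAF binder
`hloc : loc_y(Φ v μ) ≤ β·loc_y μ·loc_y v` of `B11Ineq189.hasMaj₂_local` ∕ `d2D_shape` — and (ii) the leaves at NORM level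
(`B11Ineq189LocalLeaf.norm_fderiv_fderiv_quad_le`: ‖D²C(X)[u,v]‖ ≤ 9C₂‖u‖‖v‖ for a quadratic-analytic `C` on ‖X‖ < R∕3;
instantiated for [4]'s `C_k` in `B11Ineq189LeafCk` and for the concrete Sect. C map `D` in `B11Ineq189LeafD`, seat n07-b).
THIS FILE is the junction: on the ONE-SITE carrier of `B11Prop9ModelNonVacuity` (`toyGeometry`: one block, `dist = 0`;
`normBlockNorm F`: `loc = ‖·‖`, `cut = id`, `κ = 1`) — the carrier of record for norm-level statements (n07-b's default,
dag-lead l.9488) — (§1) a block majorant `a·e^{−ρd}` IS an operator-norm bound `‖Tμ‖ ≤ a‖μ‖` and a joint majorant IS a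
bilinear norm bound (`hasMaj_norm_iff`, `hasMaj₂_norm_iff`; the row sum of Lemma 2.1 is `1`, (2.54) trivial); (§2) a
bilinear norm bound `‖Φ v μ‖ ≤ β‖μ‖‖v‖` IS the `hloc` binder and gives the `HasMaj₂` leaf binder at any rates
(`hloc_of_norm_bound`, `hasMaj₂_of_norm_bound`), and n07-b's leaf theorem discharges it with `β = 9C₂` BY NAME
(`hasMaj₂_of_fderiv_fderiv_quad`: hypotheses = those of `norm_fderiv_fderiv_quad_le` verbatim + «Φ is D²C(X) read as an
ℝ-bilinear map»); (§3) the census rows specialise to norm bookkeeping BY NAME: the located intermediate δ𝔇 (`d2D_norm`, from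
`B11Ineq189.d2D_shape`: ‖S(Φ(U′v)(Rμ))‖ ≤ a_S·β·a_R·a_{U′}·‖μ‖‖v‖ with `a_S = 2` of (71)), a SHAPE B row (`term189_norm`, from
`term189_of_d2D`: ‖T[v]X‖ ≤ θ·M·‖v‖) and the SHAPE L composition rule (`comp_norm`, from `B11Ineq189Census.comp_quarter`:
norms multiply).

HONEST SCOPE.  (1) One-site carrier = NO DECAY: this module certifies the CONSTANTS junction (which leaf constant feeds
which binder, and that the binders' shapes agree definitionally), not the exponential rates — those are the abstract
census's (`B11Ineq189Census`, rates ¼δ₀ from σ = ⅛δ₀ bookkeeping) and need a multi-block `BlockNorm` on the configuration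
spaces of record (NODE 00's B11-group pin; not built here).  (2) `Φ`, `S`, `R`, `U′`, `T`, `X` are variables; the only
analytic fact consumed is n07-b's generic leaf theorem (its `C_k` ∕ concrete-`D` instances `norm_fderiv_fderiv_Ck_ins` ∕
`norm_fderiv_fderiv_D_concrete` have the same conclusion shape and plug into `hasMaj₂_of_norm_bound` the same way — not
re-derived here to avoid restating their hypothesis lists).  (3) No `def` is minted (the ℝ-bilinear reading of `D²C(X)` is a
hypothesis `hΦ`, not a construction); nothing of [B11] ∕ [3] ∕ [4] asserted; 0 sorry; axioms standard.
-/

noncomputable section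

namespace Literature.MathematicalPhysics.QuantumFieldTheory.Balaban1983to89.B11Ineq189CensusNorm

open B6RandomWalk B11SectG B11Ineq189 B11Ineq189Census B11Prop9ModelNonVacuity

variable {FA F₀ F₁ F₂ F₃ : Type} [NormedAddCommGroup FA] [NormedSpace ℂ FA] [NormedAddCommGroup F₀] [NormedSpace ℂ F₀]
  [NormedAddCommGroup F₁] [NormedSpace ℂ F₁] [NormedAddCommGroup F₂] [NormedSpace ℂ F₂] [NormedAddCommGroup F₃]
  [NormedSpace ℂ F₃]

/-! ## §1 The one-site normed carrier: block majorants are operator-norm bounds -/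

section Carrier

/-- On the one-site carrier the triangle inequality (2.54) [3] holds (all distances are `0`).
[cite: Balaban1984PropagatorsII, (2.54) p.233] -/
theorem triangle254_toy : Triangle254 toyGeometry := fun _ _ _ => by
  show (0 : ℝ) ≤ 0 + 0
  norm_num

/-- Distances on the one-site carrier are `0 ≥ 0`. [cite: Balaban1984PropagatorsII, (2.45) p.231] -/
theorem dist_nonneg_toy : ∀ a b : toyGeometry.Site, 0 ≤ toyGeometry.dist a b := fun _ _ => le_rfl

/-- On the one-site carrier the row sum (2.61) of Lemma 2.1 [3] is `1` at every rate.
[cite: Balaban1984PropagatorsII, Lemma 2.1 (2.61) p.234] -/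
theorem rowSum_toy (σ : ℝ) : RowSum toyGeometry σ 1 := by
  intro y
  show ∑ _y' : Unit, Real.exp (-(σ * 0)) ≤ 1
  simp

/-- **A block majorant `a·e^{−ρd}` on the one-site normed carrier IS the operator-norm bound `‖Tμ‖ ≤ a‖μ‖`** (the shape
(2.51) [3] ∕ (73), (189) read with one block). [cite: Balaban1984PropagatorsII, (2.51)–(2.53) p.232; Balaban1985Variational, (189) p.308] -/
theorem hasMaj_norm_iff {T : F₁ →ₗ[ℝ] F₂} {a ρ : ℝ} :
    HasMaj (normBlockNorm F₁) (normBlockNorm F₂) T (fun y y' => a * Real.exp (-(ρ * toyGeometry.dist y y'))) ↔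
      ∀ μ, ‖T μ‖ ≤ a * ‖μ‖ := by
  constructor
  · intro h μ
    have h' := h () μ trivial ()
    change ‖T μ‖ ≤ a * Real.exp (-(ρ * 0)) * ‖μ‖ at h'
    simpa using h'
  · intro h y' μ _ y
    change ‖T μ‖ ≤ a * Real.exp (-(ρ * 0)) * ‖μ‖
    simpa using h μ

/-- **A joint majorant on the one-site normed carrier IS the bilinear norm bound `‖T v μ‖ ≤ θ‖μ‖‖v‖`** (the shape of
`B11Ineq189.HasMaj₂` read with one block). [cite: Balaban1985Variational, (189) p.308] -/
theorem hasMaj₂_norm_iff {T : FA →ₗ[ℝ] F₁ →ₗ[ℝ] F₂} {θ ρ ρ' : ℝ} :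
    HasMaj₂ (normBlockNorm FA) (normBlockNorm F₁) (normBlockNorm F₂) T
        (fun y y'' y' => θ * Real.exp (-(ρ * toyGeometry.dist y y'')) * Real.exp (-(ρ' * toyGeometry.dist y y'))) ↔
      ∀ v μ, ‖T v μ‖ ≤ θ * ‖μ‖ * ‖v‖ := by
  constructor
  · intro h v μ
    have h' := h () v trivial () μ trivial ()
    change ‖T v μ‖ ≤ θ * Real.exp (-(ρ * 0)) * Real.exp (-(ρ' * 0)) * ‖μ‖ * ‖v‖ at h'
    simpa using h'
  · intro h y' v _ y'' μ _ y
    change ‖T v μ‖ ≤ θ * Real.exp (-(ρ * 0)) * Real.exp (-(ρ' * 0)) * ‖μ‖ * ‖v‖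
    simpa using h v μ

/-- The identity-locality binder of `hasMaj₂_local` ∕ `d2D_shape` on the one-site carrier: the identity has majorant
`1·e^{−ρd}` at every rate. [cite: Balaban1984PropagatorsII, (2.51) p.232] -/
theorem hasMaj_id_toy (ρ : ℝ) :
    HasMaj (normBlockNorm F₁) (normBlockNorm F₁) LinearMap.id
      (fun y y' => 1 * Real.exp (-(ρ * toyGeometry.dist y y'))) :=
  hasMaj_norm_iff.mpr fun μ => by simp

end Carrier

/-! ## §2 The leaf junction: a bilinear norm bound IS the `hloc` ∕ `HasMaj₂` binder; n07-b's leaf discharges it -/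

section Leaf

/-- **The `hloc` binder in norm form**: `‖Φ v μ‖ ≤ β‖μ‖‖v‖` is literally `loc_y(Φ v μ) ≤ β·loc_y μ·loc_y v` on the one-site
normed carrier (the hypothesis `hloc` of `B11Ineq189.hasMaj₂_local` ∕ `d2D_shape` ∕ `B11Ineq189Census.d2D2_hasMaj₂`).
[cite: Balaban1985Variational, (189) p.308; Balaban1985Averaging, Prop. 4 (134)–(135) p.38] -/
theorem hloc_of_norm_bound {Φ : FA →ₗ[ℝ] F₁ →ₗ[ℝ] F₂} {β : ℝ} (h : ∀ v μ, ‖Φ v μ‖ ≤ β * ‖μ‖ * ‖v‖) :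
    ∀ (y : toyGeometry.Site) (v : FA) (μ : F₁),
      (normBlockNorm F₂).loc y (Φ v μ) ≤ β * (normBlockNorm F₁).loc y μ * (normBlockNorm FA).loc y v :=
  fun _ v μ => h v μ

/-- **The `HasMaj₂` leaf binder from a bilinear norm bound**, at any pair of rates (one block: the exponentials are `1`):
`B11Ineq189.hasMaj₂_local` with the identity-localities `hasMaj_id_toy`. [cite: Balaban1985Variational, (189) p.308] -/
theorem hasMaj₂_of_norm_bound {Φ : FA →ₗ[ℝ] F₁ →ₗ[ℝ] F₂} {β : ℝ} (hβ : 0 ≤ β)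
    (h : ∀ v μ, ‖Φ v μ‖ ≤ β * ‖μ‖ * ‖v‖) (ρI ρA : ℝ) :
    HasMaj₂ (normBlockNorm FA) (normBlockNorm F₁) (normBlockNorm F₂) Φ
      (fun y y'' y' => β * 1 * 1 * Real.exp (-(ρI * toyGeometry.dist y y'')) *
        Real.exp (-(ρA * toyGeometry.dist y y'))) :=
  hasMaj₂_local hβ zero_le_one (hloc_of_norm_bound h) (hasMaj_id_toy ρI) (hasMaj_id_toy ρA)

/-- **n07-b's LEAF PLUGS IN BY NAME (β = 9C₂).**  For `C` complex-differentiable on the ball `‖Y‖ < R` with `‖C(Y)‖ ≤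
C₂‖Y‖²` there ([4] Prop. 4 (135) ∕ Prop. 7 for `C_j`) and a centre `‖X‖ < R∕3` — the hypotheses of
`B11Ineq189LocalLeaf.norm_fderiv_fderiv_quad_le` VERBATIM — the second derivative `D²C(X)`, read as an ℝ-bilinear family
`Φ` (`hΦ`), satisfies the census's leaf binder with `β = 9C₂` at any rates: `HasMaj₂ … Φ (9C₂·1·1·e^{−ρd}e^{−ρ′d})`.
[cite: Balaban1985Variational, (189) p.308; Balaban1985Averaging, Prop. 4 (134)–(135) p.38] -/
theorem hasMaj₂_of_fderiv_fderiv_quad [CompleteSpace F₂] {C : F₁ → F₂} {R C₂ : ℝ}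
    (hC : DifferentiableOn ℂ C (Metric.ball (0 : F₁) R))
    (hC₂ : 0 ≤ C₂) (hquad : ∀ Y : F₁, ‖Y‖ < R → ‖C Y‖ ≤ C₂ * ‖Y‖ ^ 2) {X : F₁} (hX : ‖X‖ < R / 3)
    {Φ : F₁ →ₗ[ℝ] F₁ →ₗ[ℝ] F₂} (hΦ : ∀ u v, Φ u v = fderiv ℂ (fderiv ℂ C) X u v) (ρI ρA : ℝ) :
    HasMaj₂ (normBlockNorm F₁) (normBlockNorm F₁) (normBlockNorm F₂) Φ
      (fun y y'' y' => 9 * C₂ * 1 * 1 * Real.exp (-(ρI * toyGeometry.dist y y'')) *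
        Real.exp (-(ρA * toyGeometry.dist y y'))) := by
  refine hasMaj₂_of_norm_bound (by positivity) (fun v μ => ?_) ρI ρA
  rw [hΦ]
  have h := B11Ineq189LocalLeaf.norm_fderiv_fderiv_quad_le hC hC₂ hquad hX v μ
  calc ‖fderiv ℂ (fderiv ℂ C) X v μ‖ ≤ 9 * C₂ * ‖v‖ * ‖μ‖ := h
    _ = 9 * C₂ * ‖μ‖ * ‖v‖ := by ring

/-- The same junction in plain norm form: `‖Φ v μ‖ ≤ 9C₂‖μ‖‖v‖` for the ℝ-bilinear reading of `D²C(X)`.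
[cite: Balaban1985Variational, (189) p.308; Balaban1985Averaging, Prop. 4 (134)–(135) p.38] -/
theorem norm_bound_of_fderiv_fderiv_quad [CompleteSpace F₂] {C : F₁ → F₂} {R C₂ : ℝ}
    (hC : DifferentiableOn ℂ C (Metric.ball (0 : F₁) R))
    (hC₂ : 0 ≤ C₂) (hquad : ∀ Y : F₁, ‖Y‖ < R → ‖C Y‖ ≤ C₂ * ‖Y‖ ^ 2) {X : F₁} (hX : ‖X‖ < R / 3)
    {Φ : F₁ →ₗ[ℝ] F₁ →ₗ[ℝ] F₂} (hΦ : ∀ u v, Φ u v = fderiv ℂ (fderiv ℂ C) X u v) :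
    ∀ v μ, ‖Φ v μ‖ ≤ 9 * C₂ * ‖μ‖ * ‖v‖ := by
  have h := (hasMaj₂_norm_iff (T := Φ) (θ := 9 * C₂) (ρ := 0) (ρ' := 0)).mp
    ((hasMaj₂_of_fderiv_fderiv_quad hC hC₂ hquad hX hΦ 0 0).mono fun y y'' y' => le_of_eq (by ring))
  exact h

end Leaf

/-! ## §3 The census rows specialise to norm bookkeeping BY NAME -/

section Rows

/-- **THE LOCATED INTERMEDIATE δ𝔇 AT NORM LEVEL, from `B11Ineq189.d2D_shape` BY NAME**: one term of `δ𝔇[v]μ =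
S(Φ(U′v)(Rμ))` with `‖Sx‖ ≤ a_S‖x‖` ((71): `a_S = 2`), `‖Rμ‖ ≤ a_R‖μ‖` (restriction or `H𝔇`), `‖U′v‖ ≤ a_{U′}‖v‖`
(`U′ = I − H𝔇`) and the leaf `‖Φ v μ‖ ≤ β‖μ‖‖v‖` (§2) satisfies `‖δ𝔇[v]μ‖ ≤ a_S·β·a_R·a_{U′}·‖μ‖‖v‖` — `d2D_shape` on the
one-site carrier (`thetaShape 1 1 1 β 1 1 a_R a_{U′} a_S 1`). [cite: Balaban1985Variational, (68)–(73) pp.288–289 + (189) p.308] -/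
theorem d2D_norm {Φ : FA →ₗ[ℝ] F₁ →ₗ[ℝ] F₂} {R : F₀ →ₗ[ℝ] F₁} {U' : F₃ →ₗ[ℝ] FA} {S : F₂ →ₗ[ℝ] F₃}
    {T : F₃ →ₗ[ℝ] F₀ →ₗ[ℝ] F₃} {β aR aU' aS : ℝ} (hβ : 0 ≤ β) (haR : 0 ≤ aR) (haU' : 0 ≤ aU') (haS : 0 ≤ aS)
    (hΦ : ∀ v μ, ‖Φ v μ‖ ≤ β * ‖μ‖ * ‖v‖) (hR : ∀ μ, ‖R μ‖ ≤ aR * ‖μ‖) (hU' : ∀ v, ‖U' v‖ ≤ aU' * ‖v‖)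
    (hS : ∀ x, ‖S x‖ ≤ aS * ‖x‖) (hT : ∀ v' ν, T v' ν = S (Φ (U' v') (R ν))) :
    ∀ v' ν, ‖T v' ν‖ ≤ aS * β * aR * aU' * ‖ν‖ * ‖v'‖ := by
  have h := d2D_shape (bN := normBlockNorm F₃) (bA := normBlockNorm FA) (b₀ := normBlockNorm F₀)
    (b₁ := normBlockNorm F₁) (b₂ := normBlockNorm F₂) (b₃ := normBlockNorm F₃) (δ₀ := 0)
    triangle254_toy dist_nonneg_toy le_rfl (rowSum_toy (0 / 8)) hβ zero_le_one zero_le_one haR haU' haS zero_le_one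
    (hloc_of_norm_bound hΦ) (hasMaj_id_toy 0) (hasMaj_id_toy 0)
    ((hasMaj_norm_iff (ρ := 0 / 2)).mpr hR) ((hasMaj_norm_iff (ρ := 0 / 2)).mpr hU')
    ((hasMaj_norm_iff (ρ := 0 / 2)).mpr hS) hT
  have h' := (hasMaj₂_norm_iff (ρ := 0 / 8) (ρ' := 0 / 4)).mp h
  intro v' ν
  refine (h' v' ν).trans (le_of_eq ?_)
  show thetaShape 1 1 1 β 1 1 aR aU' aS 1 * ‖ν‖ * ‖v'‖ = _
  unfold thetaShape
  ring

/-- **A SHAPE B ROW AT NORM LEVEL, from `B11Ineq189.term189_of_d2D` BY NAME**: a family with `‖T[v]μ‖ ≤ θ‖μ‖‖v‖`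
contracted against a FIXED `X` with `‖X‖ ≤ M` (the census's `h`, `X₃`, `X₄`, `K₃D(A′)`, `H*w`, `H*q_α`) gives the operator
`W v = T[v]X` with `‖Wv‖ ≤ θ·M·‖v‖`. [cite: Balaban1985Variational, (85), (88) pp.291–292 + (189) p.308] -/
theorem term189_norm {T : FA →ₗ[ℝ] F₀ →ₗ[ℝ] F₃} {X : F₀} {W : FA →ₗ[ℝ] F₃} {θ M : ℝ} (hθ : 0 ≤ θ) (hM : 0 ≤ M)
    (hT : ∀ v μ, ‖T v μ‖ ≤ θ * ‖μ‖ * ‖v‖) (hX : ‖X‖ ≤ M) (hW : ∀ v, W v = T v X) :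
    ∀ v, ‖W v‖ ≤ θ * M * ‖v‖ := by
  have h := term189_of_d2D (bN := normBlockNorm FA) (b₀ := normBlockNorm F₀) (b₃ := normBlockNorm F₃) (δ₀ := 0)
    dist_nonneg_toy (rowSum_toy (0 / 8)) hθ hM ((hasMaj₂_norm_iff (ρ := 0 / 8) (ρ' := 0 / 4)).mpr hT)
    (fun _ => hX) hW
  have h' := (hasMaj_norm_iff (ρ := 0 / 4)).mp h
  intro v
  refine (h' v).trans (le_of_eq ?_)
  show 1 * θ * M * 1 * ‖v‖ = _
  ring

/-- **THE SHAPE L COMPOSITION RULE AT NORM LEVEL, from `B11Ineq189Census.comp_quarter` BY NAME**: operator norms multiply,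
`‖T₁(T₂μ)‖ ≤ a₁a₂‖μ‖` (one block: `κ = 1`, `c = 1`). [cite: Balaban1984PropagatorsII, (2.52)–(2.55) p.232] -/
theorem comp_norm {T₁ : F₂ →ₗ[ℝ] F₃} {T₂ : F₁ →ₗ[ℝ] F₂} {a₁ a₂ : ℝ} (ha₁ : 0 ≤ a₁) (ha₂ : 0 ≤ a₂)
    (h₁ : ∀ x, ‖T₁ x‖ ≤ a₁ * ‖x‖) (h₂ : ∀ μ, ‖T₂ μ‖ ≤ a₂ * ‖μ‖) : ∀ μ, ‖T₁ (T₂ μ)‖ ≤ a₁ * a₂ * ‖μ‖ := by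
  have h := comp_quarter (b₁ := normBlockNorm F₁) (b₂ := normBlockNorm F₂) (b₃ := normBlockNorm F₃) (δ₀ := 0)
    (ρ₁ := 0 / 4) triangle254_toy dist_nonneg_toy le_rfl (rowSum_toy (0 / 8)) ha₁ ha₂ (by norm_num)
    ((hasMaj_norm_iff (ρ := 0 / 4)).mpr h₁) ((hasMaj_norm_iff (ρ := 0 / 4)).mpr h₂)
  have h' := (hasMaj_norm_iff (ρ := 0 / 4)).mp h
  intro μ
  refine (h' μ).trans (le_of_eq ?_)
  show 1 * a₁ * a₂ * 1 * ‖μ‖ = _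
  ring

end Rows

end Literature.MathematicalPhysics.QuantumFieldTheory.Balaban1983to89.B11Ineq189CensusNorm

end
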